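import Mathlib
import HarnessLib
import Summits.Ventures.LatticeQCDFlow.Exactness.NCMCGeneralSpaceReplicaTStatisticChains
import Summits.Ventures.LatticeQCDFlow.Exactness.NCMCGeneralSpaceReplicaTStatisticCoverage

/-!
# The replica-`t` interval of `R ≥ 2` independent chains has ONE limiting coverage `L_R(q)` — the same number for every chain, observable, and family of starts

HONEST FRAMING: exact (Metropolis-corrected) sampling algorithms for lattice gauge theory;
figures of merit are autocorrelation/cost numbers at stated couplings and volumes; no
continuum-physics claim.

Venture `LatticeQCDFlow` (cell pub-lqcd), topic `Exactness`; FANOUT row 13 (`eng-snf`, GEN-23, replica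
pooling).  NEW WORK of the cell (composition of `NCMCGeneralSpaceReplicaTStatisticChains` — `t_n ⇒ t(Z)`
— with `NCMCGeneralSpaceReplicaTStatisticCoverage` — the law of `t(Z)` has no atoms and
`N(0, v)^{⊗R}{|t| ≤ q}` does not depend on `v`); not a published result; no definition is introduced;
nothing is cited as a fact (Student's `t_{R−1}` is NAMED ONLY: `L_R(q)` below IS `P(|t_{R−1}| ≤ q)`, but
that identification is not typed).

WHY (row 13).  `latflow-snf`'s `estimators.free_energy` / `ncmc.target_means` print a replica (block)
jackknife bar, i.e. they read the pooled mean against the SPREAD of `R` replica means with some quantile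
`q`.  Typed here, for `R ≥ 2` independent restart/NCMC chains from ANY family of initial laws and any
bounded observable with `σ²_f > 0`: the coverage of `{|t_n| ≤ q}`,
`t_n = ((1/R) Σ_r ȳ_{r,n} − πf)/√(Σ_r (ȳ_{r,n} − ȳ̄_n)²/(R(R−1)))`, converges to
`L_R(q) := N(0, 1)^{⊗R}{z | |z̄/√(Σ_r (z_r − z̄)²/(R(R−1)))| ≤ q}` — a number depending on `(R, q)`
only.  So the bar is asymptotically CALIBRATED iff `q` is chosen with `L_R(q) = 1 − α` (the `t_{R−1}`
quantile), uniformly over engines, observables and starts; read with a NORMAL quantile `z_{α/2}` its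
limiting coverage is `L_R(z_{α/2})`, which is `< 1 − α` at every finite `R` by the heavier tails of
`t_{R−1}` (neither typed nor computed here).

## Content
* **`tendsto_measure_abs_replicaTStat_le_of_nHit`** — the statement above.

NOT CLAIMED: the value of `L_R(q)`; dependent replicas; unequal replica lengths; anything numerical.
-/

namespace Summit.Ventures.LatticeQCDFlow.Exactness.GeneralNCMC

open MeasureTheory ProbabilityTheory Filter Finset WithLp
open scoped ENNReal NNReal Topology

section Chains

variable {S : Type*} [MeasurableSpace S]
  {κ : Kernel S S} [IsMarkovKernel κ] {π : Measure S} [IsProbabilityMeasure π]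
  {ν : Measure S} [IsProbabilityMeasure ν] {ε : ℝ≥0∞} {m : ℕ}
  {ι : Type*} [Fintype ι] [Nontrivial ι]

/-- **THE REPLICA-`t` INTERVAL HAS THE UNIVERSAL LIMITING COVERAGE `L_R(q)`.**  `κ` Markov, `π`
invariant, `(nHit κ m)(z, ·) ≥ ε ν` (`ε ≠ 0`, `0 < m`), `|f| ≤ C`, `σ²_f > 0`, `R = |ι| ≥ 2`
independent chains with initial laws `μ_r`, `q ≥ 0`.  Then
`P(|((1/R) Σ_r ȳ_{r,n} − πf)/√(Σ_r (ȳ_{r,n} − ȳ̄_n)²/(R(R−1)))| ≤ q) → N(0,1)^{⊗R}{|t| ≤ q}`. -/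
theorem tendsto_measure_abs_replicaTStat_le_of_nHit (hπ : Kernel.Invariant κ π) (hε : ε ≠ 0)
    (hmin : ∀ z, ε • ν ≤ nHit κ m z) (hm : 0 < m)
    {f : S → ℝ} (hf : Measurable f) {C : ℝ} (hC : ∀ x, |f x| ≤ C)
    (hσ : 0 < Scoring.autocov κ π (fun y => f y - ∫ z, f z ∂π) 0
          + 2 * ∑' t, Scoring.autocov κ π (fun y => f y - ∫ z, f z ∂π) (t + 1))
    (μ : ι → Measure S) [∀ r, IsProbabilityMeasure (μ r)]
    [∀ r, IsProbabilityMeasure (Kernel.trajMeasure (X := fun _ : ℕ => S) (μ r)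
        (fun n : ℕ => κ.comap (fun hh : (i : ↥(Finset.Iic n)) → S => hh ⟨n, Finset.mem_Iic.2 le_rfl⟩)
          (measurable_pi_apply _)))] {q : ℝ} (hq : 0 ≤ q) :
    Tendsto (fun n : ℕ => (Measure.pi fun r => Kernel.trajMeasure (X := fun _ : ℕ => S) (μ r)
        (fun n : ℕ => κ.comap (fun hh : (i : ↥(Finset.Iic n)) → S => hh ⟨n, Finset.mem_Iic.2 le_rfl⟩)
          (measurable_pi_apply _)))
        {x : ι → ℕ → S | |((∑ r, (∑ t ∈ range n, f (x r t)) / n) / Fintype.card ι - ∫ z, f z ∂π)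
          / Real.sqrt ((∑ r, ((∑ t ∈ range n, f (x r t)) / n
              - (∑ r', (∑ t ∈ range n, f (x r' t)) / n) / Fintype.card ι) ^ 2)
              / ((Fintype.card ι : ℝ) * (Fintype.card ι - 1)))| ≤ q})
      atTop
      (𝓝 ((Measure.pi fun _ : ι => gaussianReal 0 1) {z : ι → ℝ | |(∑ r, z r) / Fintype.card ι
        / Real.sqrt ((∑ r, (z r - (∑ r', z r') / Fintype.card ι) ^ 2)
            / ((Fintype.card ι : ℝ) * (Fintype.card ι - 1)))| ≤ q})) := by
  have hv : Real.toNNReal (Scoring.autocov κ π (fun y => f y - ∫ z, f z ∂π) 0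
      + 2 * ∑' t, Scoring.autocov κ π (fun y => f y - ∫ z, f z ∂π) (t + 1)) ≠ 0 := by
    rw [ne_eq, Real.toNNReal_eq_zero, not_le]
    exact hσ
  have h := tendsto_measure_abs_tStat_le_of_pi_gaussianReal hv
    (tendstoInDistribution_replicaVector_of_nHit hπ hε hmin hm hf hC μ) hq
  rw [pi_gaussianReal_measure_abs_tStat_le_eq hv] at h
  refine h.congr fun n => ?_
  congr 1
  ext x
  simp only [Set.mem_setOf_eq]
  rw [← tStat_replicaVector_eq (fun r t => f (x r t)) (∫ z, f z ∂π) n]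

end Chains

end Summit.Ventures.LatticeQCDFlow.Exactness.GeneralNCMC
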